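import Mathlib.LinearAlgebra.Matrix.Transvection
import Mathlib.LinearAlgebra.Matrix.Block
import Mathlib.Tactic.LinearCombination
import Literature.NumberTheory.Automorphic.StrongApproximationSL2
import HarnessLib

/-!
# Strong approximation for `SL_n`: `SL_n(K)` is dense in `SL_n(𝔸_K^∞)`

Topic `NumberTheory/Automorphic`; namespace `Literature.NumberTheory.Automorphic` (grouping
sub-namespace `SLnElementary` for the elementary-matrix algebra in `SL_n` over a commutative ring).
Theorems (and two bundled homomorphisms with bodies); no named fact, no instance, no `sorry`.
Sequel of `StrongApproximationSL2`, which proves the case `n = 2` by an explicit `2 × 2`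
Whitehead lemma; here the same restricted-product argument is run for all `n`:

* `SLnElementary.eq_top_of_transvection_mem` — **over a commutative ring `A` in which every
  unimodular column can be given a unit pivot by row operations, every subgroup of `SL_n(A)`
  containing all elementary matrices (transvections `1 + c E_{ij}`) is the whole group**
  (Gaussian elimination with unit pivots, by induction on `n` through `Fin r ⊕ Unit`, in the style
  of Mathlib's `Matrix.Pivot` — which treats FIELDS — with the reindexing
  `SLnElementary.reindexEquiv`
  and the block embedding `SLnElementary.blockEmbed : SL_r ↪ SL_{r+1}`);
* `FiniteAdeleRing.exists_isUnit_pivot` — the hypothesis holds for the finite adele ring of a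
  Dedekind domain: for a unimodular column `a` over `𝔸_K^∞` some `a_p + ∑ t_i a_i` is a unit
  (chosen place by place; where the column is integral, unimodularity forces a unit entry);
* `transvection_mem_topologicalClosure_range_sl` — the adelic transvections lie in the closure of
  the image of `SL_n(K)` (`K` is dense in `𝔸_K^∞`, `denseRange_algebraMap_finiteAdeleRing`);
* `specialLinearGroup_denseRange_map_finiteAdeleRing` — **strong approximation: `SL_n(K)` is
  dense in `SL_n(𝔸_K^∞)`** for the fraction field `K` of a Dedekind domain and every finite index
  type; `exists_specialLinearGroup_map_mul_eq_of_isOpen` — **`SL_n(𝔸_K^∞) = SL_n(K) · U` for every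
  open subgroup `U`**.

This is the theorem of Eichler and Kneser for `SL_n` (Platonov–Rapinchuk, Thm. 7.12: `G(K)` is
dense in `G(𝔸_K^S)` for `G` simply connected absolutely almost simple with `G_S` non-compact;
here `G = SL_n`, `S ⊇` the archimedean places), in the elementary form "`SL_n` of the adele ring
is generated by elementary matrices, and `K` is dense in the finite adeles" (cf. Bump, Thm. 3.3.1
and its proof for `n = 2` over `ℚ`). Consumers: the finiteness of `GL_n(K)\GL_n(𝔸_K^∞)/U`
(finitely many components of the arithmetic quotients of `GL_n`, `FinitelyManyComponentsGLn`).

## References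

* V. Platonov, A. Rapinchuk, *Algebraic groups and number theory*, Academic Press (1994), §7.4,
  Thm. 7.12 [PlatonovRapinchuk1994].
* D. Bump, *Automorphic forms and representations* (1997), Thm. 3.3.1 [Bump1997].
-/

noncomputable section

open Matrix Matrix.SpecialLinearGroup
open scoped MatrixGroups

namespace Literature.NumberTheory.Automorphic

/-! ### Elementary matrices generate `SL_n` over rings with reachable unit pivots -/

namespace SLnElementary


variable {A : Type*} [CommRing A]

section Reindex

variable {ι κ : Type*} [Fintype ι] [DecidableEq ι] [Fintype κ] [DecidableEq κ]

/-- The underlying matrix of the transvection `1 + c E_{ij} ∈ SL(ι, A)` (Mathlib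
`SpecialLinearGroup.transvection`) is Mathlib's `Matrix.transvection i j c`. [folklore] -/
theorem coe_transvection_eq {i j : ι} (hij : i ≠ j) (c : A) :
    ((transvection hij c : SpecialLinearGroup ι A) : Matrix ι ι A) = Matrix.transvection i j c :=
  rfl

/-- Reindexing `SL(ι, A) ≃* SL(κ, A)` along `e : ι ≃ κ` (Mathlib `Matrix.reindex`, determinant
preserved by `Matrix.det_reindex_self`). [folklore] -/
def reindexEquiv (e : ι ≃ κ) : SpecialLinearGroup ι A ≃* SpecialLinearGroup κ A where
  toFun g := ⟨Matrix.reindex e e g, by rw [Matrix.det_reindex_self]; exact g.2⟩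
  invFun g := ⟨Matrix.reindex e.symm e.symm g, by rw [Matrix.det_reindex_self]; exact g.2⟩
  left_inv g := Subtype.ext (by simp)
  right_inv g := Subtype.ext (by simp)
  map_mul' g h := Subtype.ext (by
    change Matrix.reindex e e ((g : Matrix ι ι A) * (h : Matrix ι ι A)) =
      Matrix.reindex e e (g : Matrix ι ι A) * Matrix.reindex e e (h : Matrix ι ι A)
    simp)

/-- Underlying matrix of the reindexed element. [folklore] -/
@[simp] theorem coe_reindexEquiv (e : ι ≃ κ) (g : SpecialLinearGroup ι A) :
    ((reindexEquiv e g : SpecialLinearGroup κ A) : Matrix κ κ A) = Matrix.reindex e e g := rfl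

/-- Reindexing maps transvections to transvections (Mathlib
`TransvectionStruct.toMatrix_reindexEquiv`). [folklore] -/
theorem reindexEquiv_transvection (e : ι ≃ κ) {i j : ι} (hij : i ≠ j) (c : A) :
    reindexEquiv e (transvection hij c : SpecialLinearGroup ι A) =
      transvection (show e i ≠ e j from fun h => hij (e.injective h)) c := by
  refine Subtype.ext ?_
  rw [coe_reindexEquiv, coe_transvection_eq, coe_transvection_eq]
  have := TransvectionStruct.toMatrix_reindexEquiv e ⟨i, j, hij, c⟩
  simpa [TransvectionStruct.toMatrix, TransvectionStruct.reindexEquiv] using this.symm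

end Reindex

section Block

variable {r : ℕ}

/-- The block embedding `SL(r, A) →* SL(Fin r ⊕ Unit, A)`, `M ↦ diag(M, 1)` (Mathlib
`Matrix.fromBlocks`, `det_fromBlocks_zero₂₁`). [folklore] -/
def blockEmbed : SpecialLinearGroup (Fin r) A →* SpecialLinearGroup (Fin r ⊕ Unit) A where
  toFun M := ⟨Matrix.fromBlocks (M : Matrix (Fin r) (Fin r) A) 0 0 1, by
    rw [Matrix.det_fromBlocks_zero₂₁, M.2, Matrix.det_one, one_mul]⟩
  map_one' := Subtype.ext (by simp [Matrix.fromBlocks_one])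
  map_mul' M N := Subtype.ext (by
    change Matrix.fromBlocks ((M : Matrix (Fin r) (Fin r) A) * (N : Matrix (Fin r) (Fin r) A)) 0 0
        (1 : Matrix Unit Unit A) =
      Matrix.fromBlocks (M : Matrix (Fin r) (Fin r) A) 0 0 (1 : Matrix Unit Unit A) *
        Matrix.fromBlocks (N : Matrix (Fin r) (Fin r) A) 0 0 (1 : Matrix Unit Unit A)
    rw [Matrix.fromBlocks_multiply]
    simp)

/-- Underlying matrix of the block embedding. [folklore] -/
@[simp] theorem coe_blockEmbed (M : SpecialLinearGroup (Fin r) A) :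
    ((blockEmbed M : SpecialLinearGroup (Fin r ⊕ Unit) A) :
        Matrix (Fin r ⊕ Unit) (Fin r ⊕ Unit) A) =
      Matrix.fromBlocks (M : Matrix (Fin r) (Fin r) A) 0 0 (1 : Matrix Unit Unit A) := rfl

/-- The block embedding maps transvections to transvections (Mathlib
`TransvectionStruct.toMatrix_sumInl`). [folklore] -/
theorem blockEmbed_transvection {i j : Fin r} (hij : i ≠ j) (c : A) :
    blockEmbed (transvection hij c : SpecialLinearGroup (Fin r) A) =
      transvection (show (Sum.inl i : Fin r ⊕ Unit) ≠ Sum.inl j from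
        fun h => hij (Sum.inl_injective h)) c := by
  refine Subtype.ext ?_
  rw [coe_blockEmbed, coe_transvection_eq, coe_transvection_eq]
  exact (TransvectionStruct.toMatrix_sumInl (p := Unit) ⟨i, j, hij, c⟩).symm

end Block

/-! ### Gaussian elimination inside a subgroup containing the transvections -/

section Elimination

open Sum

variable {r : ℕ} (H : Subgroup (SpecialLinearGroup (Fin r ⊕ Unit) A))
  (hH : ∀ (i j : Fin r ⊕ Unit) (hij : i ≠ j) (c : A), transvection hij c ∈ H)

-- local shorthands for this section only (unexported)
local notation "SLr" => SpecialLinearGroup (Fin r ⊕ Unit) A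
local notation "Mat" => Matrix (Fin r ⊕ Unit) (Fin r ⊕ Unit) A

include hH in
/-- Row accumulation into the pivot row: some `h ∈ H` with `h g` having the rows `inl i` of `g`
and pivot row `g_{inr} + ∑_{i ∈ s} t_i g_{inl i}`. [folklore] -/
theorem exists_mem_pivotRow_add_sum (g : SLr) (t : Fin r → A) (s : Finset (Fin r)) :
    ∃ h ∈ H, (∀ (i : Fin r) (b : Fin r ⊕ Unit),
        ((h * g : SLr) : Mat) (inl i) b = (g : Mat) (inl i) b) ∧
      ∀ b : Fin r ⊕ Unit, ((h * g : SLr) : Mat) (inr ()) b =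
        (g : Mat) (inr ()) b + ∑ i ∈ s, t i * (g : Mat) (inl i) b := by
  classical
  induction s using Finset.induction_on with
  | empty => exact ⟨1, H.one_mem, fun i b => by rw [one_mul], fun b => by simp⟩
  | insert i s his ih =>
    obtain ⟨h, hh, hrow, hpiv⟩ := ih
    refine ⟨transvection (show (inr () : Fin r ⊕ Unit) ≠ inl i from Sum.inr_ne_inl) (t i) * h,
      H.mul_mem (hH _ _ _ _) hh, fun i' b => ?_, fun b => ?_⟩
    · rw [mul_assoc, coe_mul, coe_transvection_eq,
        transvection_mul_apply_of_ne _ _ _ _ Sum.inl_ne_inr, hrow]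
    · rw [mul_assoc, coe_mul, coe_transvection_eq, transvection_mul_apply_same, hpiv, hrow,
        Finset.sum_insert his]
      ring

include hH in
/-- Clearing the pivot column (pivot entry `1`): some `h ∈ H` with `(h g)_{inl i, inr} = 0` for
`i ∈ s`, the other rows `inl i` and the pivot row unchanged. [folklore] -/
theorem exists_mem_col_eq_zero (g : SLr) (hg : (g : Mat) (inr ()) (inr ()) = 1)
    (s : Finset (Fin r)) :
    ∃ h ∈ H, (∀ i ∈ s, ((h * g : SLr) : Mat) (inl i) (inr ()) = 0) ∧
      (∀ i ∉ s, ∀ b, ((h * g : SLr) : Mat) (inl i) b = (g : Mat) (inl i) b) ∧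
      ∀ b, ((h * g : SLr) : Mat) (inr ()) b = (g : Mat) (inr ()) b := by
  classical
  induction s using Finset.induction_on with
  | empty => exact ⟨1, H.one_mem, fun i hi => absurd hi (Finset.notMem_empty i),
      fun i _ b => by rw [one_mul], fun b => by rw [one_mul]⟩
  | insert i s his ih =>
    obtain ⟨h, hh, hzero, hrow, hpiv⟩ := ih
    set x : A := ((h * g : SLr) : Mat) (inl i) (inr ()) with hx
    refine ⟨transvection (show (inl i : Fin r ⊕ Unit) ≠ inr () from Sum.inl_ne_inr) (-x) * h,
      H.mul_mem (hH _ _ _ _) hh, fun i' hi' => ?_, fun i' hi' b => ?_, fun b => ?_⟩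
    · rcases Finset.mem_insert.1 hi' with rfl | hi's
      · rw [mul_assoc, coe_mul, coe_transvection_eq, transvection_mul_apply_same, hpiv, hg, ← hx]
        ring
      · have hne : (inl i' : Fin r ⊕ Unit) ≠ inl i := fun h => his (Sum.inl_injective h ▸ hi's)
        rw [mul_assoc, coe_mul, coe_transvection_eq, transvection_mul_apply_of_ne _ _ _ _ hne,
          hzero i' hi's]
    · have hne : (inl i' : Fin r ⊕ Unit) ≠ inl i := fun h =>
        hi' (Sum.inl_injective h ▸ Finset.mem_insert_self i s)
      rw [mul_assoc, coe_mul, coe_transvection_eq, transvection_mul_apply_of_ne _ _ _ _ hne,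
        hrow i' (fun h => hi' (Finset.mem_insert_of_mem h))]
    · rw [mul_assoc, coe_mul, coe_transvection_eq,
        transvection_mul_apply_of_ne _ _ _ _ Sum.inr_ne_inl, hpiv]

include hH in
/-- Clearing the pivot row by column operations (pivot entry `1`): some `h ∈ H` with
`(g h)_{inr, inl j} = 0` for `j ∈ s`, the other columns `inl j` and the pivot column unchanged.
[folklore] -/
theorem exists_mem_row_eq_zero (g : SLr) (hg : (g : Mat) (inr ()) (inr ()) = 1)
    (s : Finset (Fin r)) :
    ∃ h ∈ H, (∀ j ∈ s, ((g * h : SLr) : Mat) (inr ()) (inl j) = 0) ∧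
      (∀ j ∉ s, ∀ a, ((g * h : SLr) : Mat) a (inl j) = (g : Mat) a (inl j)) ∧
      ∀ a, ((g * h : SLr) : Mat) a (inr ()) = (g : Mat) a (inr ()) := by
  classical
  induction s using Finset.induction_on with
  | empty => exact ⟨1, H.one_mem, fun j hj => absurd hj (Finset.notMem_empty j),
      fun j _ a => by rw [mul_one], fun a => by rw [mul_one]⟩
  | insert j s hjs ih =>
    obtain ⟨h, hh, hzero, hcol, hpiv⟩ := ih
    set x : A := ((g * h : SLr) : Mat) (inr ()) (inl j) with hx
    refine ⟨h * transvection (show (inr () : Fin r ⊕ Unit) ≠ inl j from Sum.inr_ne_inl) (-x),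
      H.mul_mem hh (hH _ _ _ _), fun j' hj' => ?_, fun j' hj' a => ?_, fun a => ?_⟩
    · rcases Finset.mem_insert.1 hj' with rfl | hj's
      · rw [← mul_assoc, coe_mul, coe_transvection_eq, mul_transvection_apply_same, hpiv, hg, ← hx]
        ring
      · have hne : (inl j' : Fin r ⊕ Unit) ≠ inl j := fun h => hjs (Sum.inl_injective h ▸ hj's)
        rw [← mul_assoc, coe_mul, coe_transvection_eq, mul_transvection_apply_of_ne _ _ _ _ hne,
          hzero j' hj's]
    · have hne : (inl j' : Fin r ⊕ Unit) ≠ inl j := fun h =>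
        hj' (Sum.inl_injective h ▸ Finset.mem_insert_self j s)
      rw [← mul_assoc, coe_mul, coe_transvection_eq, mul_transvection_apply_of_ne _ _ _ _ hne,
        hcol j' (fun h => hj' (Finset.mem_insert_of_mem h))]
    · rw [← mul_assoc, coe_mul, coe_transvection_eq,
        mul_transvection_apply_of_ne _ _ _ _ Sum.inr_ne_inl, hpiv]

include hH in
/-- Making the pivot entry `1` from a unit pivot `α` (with `r ≥ 1`, using the row `inl i₀`):
`T(p, i₀, 1) T(i₀, p, (1 - α)α⁻¹) T(i₀, p, -x α⁻¹) g` has pivot `1`, where `x = g_{i₀, p}`.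
[folklore] -/
theorem exists_mem_pivot_eq_one (g : SLr) (hg : IsUnit ((g : Mat) (inr ()) (inr ()))) (i₀ : Fin r) :
    ∃ h ∈ H, ((h * g : SLr) : Mat) (inr ()) (inr ()) = 1 := by
  obtain ⟨e, he⟩ := hg.exists_right_inv
  set α : A := (g : Mat) (inr ()) (inr ()) with hα
  set x : A := (g : Mat) (inl i₀) (inr ()) with hx
  have h1 : (inl i₀ : Fin r ⊕ Unit) ≠ inr () := Sum.inl_ne_inr
  have h2 : (inr () : Fin r ⊕ Unit) ≠ inl i₀ := Sum.inr_ne_inl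
  refine ⟨transvection h2 1 * (transvection h1 ((1 - α) * e) * transvection h1 (-(x * e))),
    H.mul_mem (hH _ _ _ _) (H.mul_mem (hH _ _ _ _) (hH _ _ _ _)), ?_⟩
  simp only [coe_mul, coe_transvection_eq, Matrix.mul_assoc]
  rw [transvection_mul_apply_same, transvection_mul_apply_of_ne _ _ _ _ h2,
    transvection_mul_apply_of_ne _ _ _ _ h2, transvection_mul_apply_same,
    transvection_mul_apply_same, transvection_mul_apply_of_ne _ _ _ _ h2, ← hα, ← hx]
  linear_combination (1 - α - x) * he

include hH in
/-- **Inductive step**: if `SL(r, A)` is generated by transvections (in the strong sense that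
every subgroup containing them is everything) and the pivot column of every matrix over `A` can
be made a unit by row operations, then every subgroup of `SL(Fin r ⊕ Unit, A)` containing the
transvections is everything. [folklore] -/
theorem eq_top_of_transvection_mem_step
    (hA : ∀ (r : ℕ) (a c : Fin r ⊕ Unit → A), ∑ i, c i * a i = 1 →
      ∃ t : Fin r → A, IsUnit (a (inr ()) + ∑ i, t i * a (inl i)))
    (IH : ∀ H' : Subgroup (SpecialLinearGroup (Fin r) A),
      (∀ (i j : Fin r) (hij : i ≠ j) (c : A), transvection hij c ∈ H') → H' = ⊤) :
    H = ⊤ := by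
  classical
  rw [eq_top_iff]
  intro g _
  rcases isEmpty_or_nonempty (Fin r) with hr | ⟨⟨i₀⟩⟩
  · -- `r = 0`: the group is trivial
    have hall : ∀ a : Fin r ⊕ Unit, a = inr () := fun a => by
      rcases a with a | ⟨⟩
      · exact (IsEmpty.false a).elim
      · rfl
    haveI : Subsingleton (Fin r ⊕ Unit) := ⟨fun a b => (hall a).trans (hall b).symm⟩
    have hg1 : g = 1 := by
      refine Subtype.ext ?_
      have hdet : Matrix.det (g : Mat) = (g : Mat) (inr ()) (inr ()) :=
        Matrix.det_eq_elem_of_subsingleton _ _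
      ext a b
      rw [hall a, hall b, coe_one, Matrix.one_apply_eq, ← hdet, g.2]
    rw [hg1]
    exact H.one_mem
  · -- Step 1: make the pivot a unit
    have hunimod : ∑ i, ((g⁻¹ : SLr) : Mat) (inr ()) i * (g : Mat) i (inr ()) = 1 := by
      have h := congrArg (fun M : SLr => (M : Mat) (inr ()) (inr ())) (inv_mul_cancel g)
      simpa only [coe_mul, coe_one, Matrix.mul_apply, Matrix.one_apply_eq] using h
    obtain ⟨t, ht⟩ := hA r (fun i => (g : Mat) i (inr ())) (fun i => ((g⁻¹ : SLr) : Mat) (inr ()) i)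
      hunimod
    obtain ⟨h₁, hh₁, -, hpiv₁⟩ := exists_mem_pivotRow_add_sum H hH g t Finset.univ
    set g₁ : SLr := h₁ * g with hg₁
    have hu : IsUnit ((g₁ : Mat) (inr ()) (inr ())) := by
      rw [hpiv₁]
      exact ht
    -- Step 2: make the pivot `1`
    obtain ⟨h₂, hh₂, hpiv₂⟩ := exists_mem_pivot_eq_one H hH g₁ hu i₀
    set g₂ : SLr := h₂ * g₁ with hg₂
    -- Step 3: clear the pivot column
    obtain ⟨h₃, hh₃, hcol₃, -, hpiv₃⟩ := exists_mem_col_eq_zero H hH g₂ hpiv₂ Finset.univ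
    set g₃ : SLr := h₃ * g₂ with hg₃
    have hpiv₃' : (g₃ : Mat) (inr ()) (inr ()) = 1 := by rw [hpiv₃, hpiv₂]
    -- Step 4: clear the pivot row
    obtain ⟨h₄, hh₄, hrow₄, -, hcol₄⟩ := exists_mem_row_eq_zero H hH g₃ hpiv₃' Finset.univ
    set g₄ : SLr := g₃ * h₄ with hg₄
    -- Step 5: `g₄` is block diagonal `diag(B, 1)` with `B ∈ SL(r, A)`
    have hblock : (g₄ : Mat) = Matrix.fromBlocks (Matrix.toBlocks₁₁ (g₄ : Mat)) 0 0
        (1 : Matrix Unit Unit A) := by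
      ext a b
      rcases a with i | ⟨⟩ <;> rcases b with j | ⟨⟩
      · rfl
      · rw [Matrix.fromBlocks_apply₁₂, Matrix.zero_apply, hcol₄, hcol₃ i (Finset.mem_univ i)]
      · rw [Matrix.fromBlocks_apply₂₁, Matrix.zero_apply, hrow₄ j (Finset.mem_univ j)]
      · rw [Matrix.fromBlocks_apply₂₂, Matrix.one_apply_eq, hcol₄, hpiv₃']
    have hdetB : (Matrix.toBlocks₁₁ (g₄ : Mat)).det = 1 := by
      have h := g₄.2
      rw [hblock, Matrix.det_fromBlocks_zero₂₁, Matrix.det_one, mul_one] at h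
      exact h
    set B : SpecialLinearGroup (Fin r) A := ⟨Matrix.toBlocks₁₁ (g₄ : Mat), hdetB⟩ with hB
    have hg₄B : g₄ = blockEmbed B := Subtype.ext hblock
    -- the induction hypothesis for the pulled-back subgroup
    have hcomap : H.comap (blockEmbed (A := A) (r := r)) = ⊤ :=
      IH _ fun i j hij c => by
        rw [Subgroup.mem_comap, blockEmbed_transvection]
        exact hH _ _ _ _
    have hg₄mem : g₄ ∈ H := by
      rw [hg₄B]
      have : B ∈ H.comap (blockEmbed (A := A) (r := r)) := by rw [hcomap]; exact Subgroup.mem_top B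
      exact this
    -- Step 6: undo the elementary operations
    have hg_eq : g = (h₃ * h₂ * h₁)⁻¹ * g₄ * h₄⁻¹ := by
      rw [hg₄, hg₃, hg₂, hg₁]
      group
    rw [hg_eq]
    exact H.mul_mem (H.mul_mem (H.inv_mem (H.mul_mem (H.mul_mem hh₃ hh₂) hh₁)) hg₄mem)
      (H.inv_mem hh₄)

end Elimination

/-! ### Assembly: all sizes, any finite index type -/

section Assembly

variable {ι κ : Type*} [Fintype ι] [DecidableEq ι] [Fintype κ] [DecidableEq κ]

/-- Transport of "every subgroup containing the transvections is everything" along a reindexing.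
[folklore] -/
theorem eq_top_of_transvection_mem_of_equiv (e : ι ≃ κ)
    (h : ∀ H' : Subgroup (SpecialLinearGroup κ A),
      (∀ (i j : κ) (hij : i ≠ j) (c : A), transvection hij c ∈ H') → H' = ⊤)
    (H : Subgroup (SpecialLinearGroup ι A))
    (hH : ∀ (i j : ι) (hij : i ≠ j) (c : A), transvection hij c ∈ H) : H = ⊤ := by
  rw [eq_top_iff]
  intro g _
  have htop := h (H.map (reindexEquiv e).toMonoidHom) fun i j hij c => by
    refine ⟨reindexEquiv e.symm (transvection hij c), ?_, ?_⟩
    · rw [reindexEquiv_transvection]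
      exact hH _ _ _ _
    · change reindexEquiv e (reindexEquiv e.symm (transvection hij c)) = _
      refine Subtype.ext ?_
      simp
  have hg : reindexEquiv e g ∈ H.map (reindexEquiv e).toMonoidHom := by
    rw [htop]; exact Subgroup.mem_top _
  obtain ⟨g', hg', hgg'⟩ := hg
  have : g' = g := (reindexEquiv e).injective hgg'
  rwa [← this]

/-- **`SL_n(A)` is generated by elementary matrices over a ring in which pivot columns can be made
units** (in the strong form: every subgroup containing all transvections is the whole group).
The hypothesis — for every unimodular column `a` (`∑ c_i a_i = 1`) some `a_p + ∑_i t_i a_i` is a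
unit — holds for fields, local rings and (finite) adele rings. [folklore] -/
theorem eq_top_of_transvection_mem
    (hA : ∀ (r : ℕ) (a c : Fin r ⊕ Unit → A), ∑ i, c i * a i = 1 →
      ∃ t : Fin r → A, IsUnit (a (Sum.inr ()) + ∑ i, t i * a (Sum.inl i)))
    (H : Subgroup (SpecialLinearGroup ι A))
    (hH : ∀ (i j : ι) (hij : i ≠ j) (c : A), transvection hij c ∈ H) : H = ⊤ := by
  classical
  -- reduce to `Fin n`
  suffices hfin : ∀ (n : ℕ) (H' : Subgroup (SpecialLinearGroup (Fin n) A)),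
      (∀ (i j : Fin n) (hij : i ≠ j) (c : A), transvection hij c ∈ H') → H' = ⊤ from
    eq_top_of_transvection_mem_of_equiv (Fintype.equivFin ι) (hfin _) H hH
  intro n
  induction n with
  | zero =>
    intro H' _
    rw [eq_top_iff]
    intro g _
    rw [Subsingleton.elim g 1]
    exact H'.one_mem
  | succ n ih =>
    intro H' hH'
    have e : Fin (n + 1) ≃ Fin n ⊕ Unit := Fintype.equivOfCardEq (by simp)
    exact eq_top_of_transvection_mem_of_equiv e
      (fun H'' hH'' => eq_top_of_transvection_mem_step H'' hH'' hA ih) H' hH'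

end Assembly


end SLnElementary

/-! ### The adelic input: a unit pivot by row operations -/

open IsDedekindDomain IsDedekindDomain.HeightOneSpectrum

section Adelic

variable {R : Type*} [CommRing R] [IsDedekindDomain R] {K : Type*} [Field K] [Algebra R K]
  [IsFractionRing R K]

/-- **Row reduction over the finite adeles, `n × n`.** For a unimodular column
`a : Fin r ⊕ Unit → 𝔸_K^∞` (`∑ c_i a_i = 1`) there are finite adeles `t_i` with
`a_p + ∑_i t_i a_{inl i}` a unit (`p = inr ()` the pivot): place by place, `t_v = 0` where `a_{p,v}`
is a `v`-adic unit; otherwise one coefficient `t_{i,v} = (1 - a_{p,v})/a_{i,v}` at an index `i`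
where `a_{i,v}` is a unit if possible (making the entry `1`), else merely non-zero; where all the
`a_{i,v}, c_{i,v}` are integral (almost everywhere) `∑ c_i a_i = 1` forces some `a_{i,v}` to be a
unit, so `t` is a finite adele and the entry is everywhere non-zero and almost everywhere a unit
(Mathlib `FiniteAdeleRing.isUnit_iff`). [folklore] -/
theorem FiniteAdeleRing.exists_isUnit_pivot {r : ℕ} (a c : Fin r ⊕ Unit → FiniteAdeleRing R K)
    (hca : ∑ i, c i * a i = 1) :
    ∃ t : Fin r → FiniteAdeleRing R K,
      IsUnit (a (Sum.inr ()) + ∑ i, t i * a (Sum.inl i)) := by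
  classical
  -- evaluation at a place is a ring homomorphism
  let ev : ∀ v : HeightOneSpectrum R, FiniteAdeleRing R K →+* v.adicCompletion K := fun v =>
    { toFun := fun x => x v, map_one' := rfl, map_mul' := fun _ _ => rfl,
      map_zero' := rfl, map_add' := fun _ _ => rfl }
  have hev : ∀ v x, ev v x = x v := fun _ _ => rfl
  set p : Fin r ⊕ Unit := Sum.inr () with hp
  -- unimodularity at each place
  have hcav : ∀ v, ∑ i, c i v * a i v = 1 := fun v => by
    have h := congrArg (ev v) hca
    rw [map_sum, map_one] at h
    simp only [map_mul] at h
    exact h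
  -- where everything is integral some entry of the column is a unit
  have hint : ∀ᶠ v : HeightOneSpectrum R in Filter.cofinite,
      (∀ i, Valued.v (a i v) ≤ 1) ∧ ∀ i, Valued.v (c i v) ≤ 1 := by
    have h := fun x : FiniteAdeleRing R K => (x.2 : ∀ᶠ v in Filter.cofinite,
      x v ∈ v.adicCompletionIntegers K)
    have ha : ∀ᶠ v : HeightOneSpectrum R in Filter.cofinite, ∀ i, Valued.v (a i v) ≤ 1 := by
      rw [Filter.eventually_all]
      intro i
      filter_upwards [h (a i)] with v hv
      exact (mem_adicCompletionIntegers R K v).1 hv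
    have hc : ∀ᶠ v : HeightOneSpectrum R in Filter.cofinite, ∀ i, Valued.v (c i v) ≤ 1 := by
      rw [Filter.eventually_all]
      intro i
      filter_upwards [h (c i)] with v hv
      exact (mem_adicCompletionIntegers R K v).1 hv
    exact ha.and hc
  have hunit : ∀ v, (∀ i, Valued.v (a i v) ≤ 1) → (∀ i, Valued.v (c i v) ≤ 1) →
      ∃ i, Valued.v (a i v) = 1 := by
    intro v ha hc
    by_contra hne
    have hlt : ∀ i, Valued.v (c i v * a i v) < 1 := fun i => by
      rw [Valuation.map_mul]
      calc Valued.v (c i v) * Valued.v (a i v) ≤ 1 * Valued.v (a i v) := by gcongr; exact hc i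
        _ < 1 := by rw [one_mul]; exact lt_of_le_of_ne (ha i) fun hi => hne ⟨i, hi⟩
    have h1 : Valued.v (∑ i, c i v * a i v) < 1 :=
      Valued.v.map_sum_lt (zero_ne_one' _).symm fun i _ => hlt i
    rw [hcav v, Valuation.map_one] at h1
    exact lt_irrefl _ h1
  -- the local recipe: preferred indices at `v`
  let P : ∀ v : HeightOneSpectrum R, Fin r → Prop := fun v i =>
    a (Sum.inl i) v ≠ 0 ∧
      ((∃ j : Fin r, Valued.v (a (Sum.inl j) v) = 1) → Valued.v (a (Sum.inl i) v) = 1)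
  let good : ∀ v : HeightOneSpectrum R, Option (Fin r) := fun v =>
    if Valued.v (a p v) = 1 then none else if h : ∃ i, P v i then some h.choose else none
  have hgood : ∀ v i, good v = some i → Valued.v (a p v) ≠ 1 ∧ P v i := by
    intro v i hi
    simp only [good] at hi
    split_ifs at hi with h1 h2
    refine ⟨h1, ?_⟩
    rw [Option.some.injEq] at hi
    rw [← hi]
    exact h2.choose_spec
  have hnone : ∀ v, good v = none → Valued.v (a p v) = 1 ∨ ∀ i, ¬ P v i := by
    intro v hv
    simp only [good] at hv
    split_ifs at hv with h1 h2
    · exact Or.inl h1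
    · exact Or.inr (not_exists.1 h2)
  -- a unit entry among the `inl i` gives a preferred index
  have hP_of_unit : ∀ v (j : Fin r), Valued.v (a (Sum.inl j) v) = 1 → ∃ i, P v i :=
    fun v j hj => ⟨j, fun h0 => by rw [h0, Valuation.map_zero] at hj; exact zero_ne_one hj,
      fun _ => hj⟩
  have hP_of_ne : ∀ v (j : Fin r), a (Sum.inl j) v ≠ 0 → ∃ i, P v i := fun v j hj => by
    by_cases h : ∃ j' : Fin r, Valued.v (a (Sum.inl j') v) = 1
    · obtain ⟨j', hj'⟩ := h
      exact hP_of_unit v j' hj'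
    · exact ⟨j, hj, fun h' => (h h').elim⟩
  -- the coefficients
  let f : Fin r → ∀ v : HeightOneSpectrum R, v.adicCompletion K := fun i v =>
    if good v = some i then (1 - a p v) / a (Sum.inl i) v else 0
  have hfsum : ∀ v, ∑ i, f i v * a (Sum.inl i) v = if (good v).isSome then 1 - a p v else 0 := by
    intro v
    cases hgv : good v with
    | none =>
      simp only [Option.isSome_none, Bool.false_eq_true, ↓reduceIte]
      refine Finset.sum_eq_zero fun i _ => ?_
      simp only [f, hgv, reduceCtorEq, ↓reduceIte, zero_mul]
    | some i₀ =>
      simp only [Option.isSome_some, ↓reduceIte]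
      rw [Finset.sum_eq_single i₀]
      · simp only [f, hgv, ↓reduceIte]
        rw [div_mul_cancel₀ _ (hgood v i₀ hgv).2.1]
      · intro i _ hi
        simp only [f, hgv, Option.some.injEq]
        rw [if_neg (Ne.symm hi), zero_mul]
      · intro h
        exact absurd (Finset.mem_univ i₀) h
  -- `t_i` is a finite adele
  have hf : ∀ i, ∀ᶠ v : HeightOneSpectrum R in Filter.cofinite,
      f i v ∈ v.adicCompletionIntegers K := by
    intro i
    filter_upwards [hint] with v hv
    obtain ⟨ha, hc⟩ := hv
    rw [mem_adicCompletionIntegers]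
    simp only [f]
    split_ifs with hgi
    · obtain ⟨hp1, hPi⟩ := hgood v i hgi
      -- some entry is a unit, not the pivot, hence some `inl j`, hence `a_{inl i}` is a unit
      obtain ⟨k, hk⟩ := hunit v ha hc
      have hj : ∃ j : Fin r, Valued.v (a (Sum.inl j) v) = 1 := by
        rcases k with j | ⟨⟩
        · exact ⟨j, hk⟩
        · exact absurd hk hp1
      have hi1 : Valued.v (a (Sum.inl i) v) = 1 := hPi.2 hj
      rw [map_div₀, hi1, div_one]
      exact le_trans (Valuation.map_sub _ _ _) (max_le (by simp) (ha p))
    · simp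
  let t : Fin r → FiniteAdeleRing R K := fun i => ⟨f i, hf i⟩
  refine ⟨t, ?_⟩
  have hcoord : ∀ v, (a p + ∑ i, t i * a (Sum.inl i)) v = a p v + ∑ i, f i v * a (Sum.inl i) v := by
    intro v
    have h := (hev v _).symm.trans (map_add (ev v) (a p) (∑ i, t i * a (Sum.inl i)))
    rw [map_sum] at h
    simp only [map_mul] at h
    exact h
  rw [FiniteAdeleRing.isUnit_iff]
  constructor
  · intro v
    rw [hcoord, hfsum]
    cases hgv : good v with
    | some i₀ =>
      simp only [Option.isSome_some, ↓reduceIte, add_sub_cancel]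
      exact one_ne_zero
    | none =>
      simp only [Option.isSome_none, Bool.false_eq_true, ↓reduceIte, add_zero]
      rcases hnone v hgv with h1 | hall
      · intro h0
        rw [h0, Valuation.map_zero] at h1
        exact zero_ne_one h1
      · -- all `a_{inl i, v} = 0`, so `c_p a_p = 1` at `v`
        have hzero : ∀ i : Fin r, a (Sum.inl i) v = 0 := fun i => by
          by_contra hi
          exact hall _ (hP_of_ne v i hi).choose_spec
        intro h0
        have h := hcav v
        rw [Fintype.sum_sum_type, Finset.sum_eq_zero (fun i _ => by rw [hzero i, mul_zero]),
          zero_add, Fintype.sum_unique] at h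
        change c p v * a p v = 1 at h
        rw [h0, mul_zero] at h
        exact zero_ne_one h
  · filter_upwards [hint] with v hv
    obtain ⟨ha, hc⟩ := hv
    rw [hcoord, hfsum]
    cases hgv : good v with
    | some i₀ => simp only [Option.isSome_some, ↓reduceIte, add_sub_cancel, Valuation.map_one]
    | none =>
      simp only [Option.isSome_none, Bool.false_eq_true, ↓reduceIte, add_zero]
      rcases hnone v hgv with h1 | hall
      · exact h1
      · obtain ⟨k, hk⟩ := hunit v ha hc
        rcases k with j | ⟨⟩
        · exact (hall _ (hP_of_unit v j hk).choose_spec).elim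
        · exact hk

end Adelic

/-! ### Strong approximation for `SL_n` -/

section StrongApproximation

variable (R : Type*) [CommRing R] [IsDedekindDomain R] (K : Type*) [Field K] [Algebra R K]
  [IsFractionRing R K] {ι : Type*} [Fintype ι] [DecidableEq ι]

/-- The elementary matrices `1 + x E_{ij}`, `x ∈ 𝔸_K^∞`, lie in the closure of the image of
`SL_n(K)` in `SL_n(𝔸_K^∞)`: `x ↦ 1 + x E_{ij}` is continuous, its values on `K` are images of
elements of `SL_n(K)`, and `K` is dense in `𝔸_K^∞` (`denseRange_algebraMap_finiteAdeleRing`;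
`n = 2`: `transvection_mem_topologicalClosure_range`). [folklore] -/
theorem transvection_mem_topologicalClosure_range_sl {i j : ι} (hij : i ≠ j)
    (x : FiniteAdeleRing R K) :
    transvection hij x ∈ ((Matrix.SpecialLinearGroup.map (algebraMap K (FiniteAdeleRing R K)) :
      SpecialLinearGroup ι K →*
        SpecialLinearGroup ι (FiniteAdeleRing R K)).range).topologicalClosure := by
  have hcont := continuous_transvection (A := FiniteAdeleRing R K) hij
  have hx : x ∈ closure (Set.range (algebraMap K (FiniteAdeleRing R K))) := by
    rw [(denseRange_algebraMap_finiteAdeleRing R K).closure_range]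
    exact Set.mem_univ x
  have h := image_closure_subset_closure_image hcont ⟨x, hx, rfl⟩
  rw [← SetLike.mem_coe, Subgroup.topologicalClosure_coe]
  refine closure_mono ?_ h
  rintro _ ⟨_, ⟨k, rfl⟩, rfl⟩
  exact ⟨transvection hij k, map_transvection _ hij k⟩

/-- **Strong approximation for `SL_n` (finite adeles): `SL_n(K)` is dense in `SL_n(𝔸_K^∞)`** for
the fraction field `K` of a Dedekind domain `R` and every finite index type (Eichler, Kneser;
Platonov–Rapinchuk, Thm. 7.12, the case `G = SL_n`, `S ⊇` the archimedean places).  Proof: the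
closure `H` of the image is a subgroup containing all elementary matrices
(`transvection_mem_topologicalClosure_range_sl`), and every subgroup of `SL_n(𝔸_K^∞)` containing
them is everything (`SLnElementary.eq_top_of_transvection_mem` with
`FiniteAdeleRing.exists_isUnit_pivot`). [cite: PlatonovRapinchuk1994, Thm. 7.12]
[cite: Bump1997, Thm. 3.3.1] -/
theorem specialLinearGroup_denseRange_map_finiteAdeleRing :
    DenseRange (Matrix.SpecialLinearGroup.map (algebraMap K (FiniteAdeleRing R K)) :
      SpecialLinearGroup ι K → SpecialLinearGroup ι (FiniteAdeleRing R K)) := by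
  set φ : SpecialLinearGroup ι K →* SpecialLinearGroup ι (FiniteAdeleRing R K) :=
    Matrix.SpecialLinearGroup.map (algebraMap K (FiniteAdeleRing R K))
  have htop : φ.range.topologicalClosure = ⊤ :=
    SLnElementary.eq_top_of_transvection_mem
      (fun r a c h => FiniteAdeleRing.exists_isUnit_pivot a c h) _
      fun i j hij x => transvection_mem_topologicalClosure_range_sl R K hij x
  have h : closure (Set.range φ) = Set.univ := by
    rw [← MonoidHom.coe_range, ← Subgroup.topologicalClosure_coe, htop, Subgroup.coe_top]
  exact dense_iff_closure_eq.2 h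

/-- **`SL_n(𝔸_K^∞) = SL_n(K) · U` for every open subgroup `U`** (the working form of strong
approximation): for `g ∈ SL_n(𝔸_K^∞)` the open set `g U⁻¹ ∋ g` meets the dense image of `SL_n(K)`
(`n = 2`: `exists_specialLinearGroup_map_mul_eq`). [cite: PlatonovRapinchuk1994, Thm. 7.12] -/
theorem exists_specialLinearGroup_map_mul_eq_of_isOpen
    (U : Subgroup (SpecialLinearGroup ι (FiniteAdeleRing R K)))
    (hU : IsOpen (U : Set (SpecialLinearGroup ι (FiniteAdeleRing R K))))
    (g : SpecialLinearGroup ι (FiniteAdeleRing R K)) :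
    ∃ (γ : SpecialLinearGroup ι K) (u : SpecialLinearGroup ι (FiniteAdeleRing R K)), u ∈ U ∧
      Matrix.SpecialLinearGroup.map (algebraMap K (FiniteAdeleRing R K)) γ * u = g := by
  have hopen : IsOpen {x : SpecialLinearGroup ι (FiniteAdeleRing R K) | x⁻¹ * g ∈ U} :=
    hU.preimage ((continuous_inv).mul continuous_const)
  obtain ⟨γ, hγ⟩ :=
    (specialLinearGroup_denseRange_map_finiteAdeleRing R K).exists_mem_open hopen
      ⟨g, by simp [U.one_mem]⟩
  exact ⟨γ, _, hγ, mul_inv_cancel_left _ _⟩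

end StrongApproximation

end Literature.NumberTheory.Automorphic
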